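import Literature.IUT.LogThetaLattice.GlobalLGPFrobenioidsModFrak
import Literature.IUT.LogThetaLattice.GlobalFrobenioidModelsPlacesHyps
import Literature.IUT.LogVolume.ArithmeticDivisorsFrdBridge
import HarnessLib

/-!
# [IUTchIII] Proposition 3.7 (ii): the realification `(†𝓕⊛_𝔪𝔬𝔡)_α → (†𝓕⊛ℝ_𝔪𝔬𝔡)_α` at the model — OBJECT level;
# at the morphism level this file builds the «ℝ-divisor ENLARGEMENT» (see AUDIT NOTE) — the integral
# fractional-ideal Frobenioid of a number field inside the real-divisor one

abc-iut cell, layer L6, D-0067 wave-4 discharge seat abc-iut-w4-d005 (board row F10-a = [IUTchIII] Prop. 3.7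
(i)(ii); node IUTchIII:Prop3.7(ii)). S. Mochizuki, *Inter-universal Teichmüller Theory III*, kurims manuscript
(May 2020), Proposition 3.7 (ii), p. 110 l. 48–49: "Write `(†𝓕⊛ℝ_𝔪𝔬𝔡)_α` for the realification of `(†𝓕⊛_𝔪𝔬𝔡)_α`"
[claim key Mochizuki2012, status disputed (D-0012)]; realification of a Frobenioid = [FrdI] Prop. 5.3
(divisor monoid `Φ ↦ Φ^rlf`, rational-function monoid `ℝ·Φ^birat` — NOT the same rational functions; tree: L1
`PreFrobenioid.realification` over `RealificationData.realSpan`) [cite: MochizukiFrdI2008, Prop. 5.3 p.103].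

The tree holds TWO model data for Example 3.6 (ii) on a number field `F`:
* the INTEGRAL datum (abc-iut-w4-d005 `Prop37.Gamma/nonneg/beta` over abc-iut-L1-t3's `Places F =
  InfinitePlace F ⊕ FinitePlace F`, `Γ_v = ℤ` at finite places — genuine fractional ideals): the category
  `Prop37.Ffrak F` = `(†𝓕⊛_𝔪𝔬𝔡)_α`;
* the REAL datum (abc-iut-L6-d1 `ModelPlaces F = HeightOneSpectrum (𝓞 F) ⊕ InfinitePlace F`, `Γ_v = ℝ`,
  `betaModel`, `nonnegModel`; abc-iut-L6-d3 `ModelFrakObj`; abc-iut-w4-d015's Prop. 3.7 (v) objects live here):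
  the category `FrakCat F (ModelPlaces F) (fun _ => ℝ) nonnegModel betaModel` = the «ℝ-divisor ENLARGEMENT» of
  `(†𝓕⊛_𝔪𝔬𝔡)_α`: it has exactly the OBJECTS of the realification `(†𝓕⊛ℝ_𝔪𝔬𝔡)_α` (`(Φ^rlf)^gp` = abc-iut-L6-d3's
  `ModelFrakObj F`) but KEEPS the rational-function monoid `F^×_mod`; print's `(†𝓕⊛ℝ_𝔪𝔬𝔡)_α` ([FrdI] Prop. 5.3;
  [IUTchIII] Rmk. 3.6.2 (i)(a) p. 109) is its image under `f ↦ Div(f) ∈ ℝ·Φ^birat` — that last functor is NOT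
  constructed here (L1 `PreFrobenioid.realification` slot; model version = successor file R2). (Its `ModelHyps`
  is abc-iut-w4-d005's `modelHyps_places`.)
THIS FILE constructs the ENLARGEMENT FUNCTOR between them (`Prop37.realify F : Ffrak F ⥤ …`), whose OBJECT MAP
`realifyObj` IS the object map of the realification `𝒞 → 𝒞^rlf` (the part Prop. 3.7 (v) p. 112 uses): on objects
the classes are re-indexed along Mathlib's `FinitePlace.mk / FinitePlace.maximalIdeal` and cast `ℤ ↪ ℝ`
(`Prop37.realifyObj`, an injective additive homomorphism `Prop37.realifyObjHom`); on morphisms `(n, f) ↦ (n, f)`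
(the rational function is unchanged — the enlargement; [FrdI] Prop. 5.3's realification further replaces `f` by
`Div(f) ∈ ℝ·Φ^birat`). PROVED: the principal families correspond
(`realifyObj_betaDiv`: `β_v` of the integral datum casts to abc-iut-L6-d1's `betaModel`, via abc-iut-L6-d3's
`betaFin_apply` and `Literature.IUT.LogVolume.ordFin_mk_eq_ord`), effectivity corresponds
(`realifyObj_mem_effDiv_iff`), the functor is faithful and full (`realify_faithful`, `realify_full`:
integrality of an integer datum read in `ℝ` is integrality in `ℤ`) and injective on objects
(`realifyObj_injective`) — `(†𝓕⊛_𝔪𝔬𝔡)_α` is a full subcategory of the ENLARGEMENT (same rational functions).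
AUDIT NOTE (abc-iut-w5-d161 F-w5d161-1 and abc-iut-w5-d153 F-w5d153-1, 2026-08-26; repair R1 = this doc
revision, declarations unchanged): `realify_faithful` / `realify_full` are properties of the ENLARGEMENT, not of
print's realification functor `𝒞 → 𝒞^rlf`, which is NEITHER faithful (`f` and `−f` have the same real divisor)
NOR full, and which IS essentially surjective at a number field (iso classes `≅ ℝ` via degree, by finiteness of
the class group and Dirichlet's unit theorem) — the earlier gloss «not essentially surjective, as a realification
should not be» is WITHDRAWN. Degree / log-volume consumers (Prop. 3.7 (v), Prop. 3.9 (iii)) use only the object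
level and are unaffected; Hom-set / iso-class statements about `(†𝓕⊛ℝ_𝔪𝔬𝔡)_α` must NOT be read off this category.

Nothing in this file takes a side on [IUTchIII] Cor. 3.12; typed ≠ discharged; instantiated ≠ endorsed.
-/

noncomputable section

namespace Literature.IUT.LogThetaLattice

namespace Prop37

open CategoryTheory NumberField IsDedekindDomain GlobalFrobenioidModels
open Literature.AlgebraicGeometry.Frobenioids (Places ordFin)

variable (F : Type) [Field F] [NumberField F]

/-! ### Re-indexing the places and casting the classes -/

/-- The classes of an integral family read in the real datum: at the maximal ideal `v` the integer class at
Mathlib's finite place `w(v)`, cast to `ℝ`; at an archimedean place the (real) class itself.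
[claim: Mochizuki2012, status: disputed] -/
def realifyCls (J : FrakObj (Places F) (Gamma F)) : ModelPlaces F → ℝ
  | .inl v => ((J.cls (.inr (FinitePlace.mk v)) : ℤ) : ℝ)
  | .inr w => (J.cls (.inl w) : ℝ)

/-- `realifyCls` at a finite place. [claim: Mochizuki2012, status: disputed] -/
@[simp] theorem realifyCls_inl (J : FrakObj (Places F) (Gamma F)) (v : HeightOneSpectrum (𝓞 F)) :
    realifyCls F J (.inl v) = ((J.cls (.inr (FinitePlace.mk v)) : ℤ) : ℝ) := rfl

/-- `realifyCls` at an archimedean place. [claim: Mochizuki2012, status: disputed] -/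
@[simp] theorem realifyCls_inr (J : FrakObj (Places F) (Gamma F)) (w : InfinitePlace F) :
    realifyCls F J (.inr w) = (J.cls (.inl w) : ℝ) := rfl

/-- The map of index sets `𝕍 = V(F) → ModelPlaces F` used to control supports: a finite place goes to its
maximal ideal, an archimedean place to itself. [claim: Mochizuki2012, status: disputed] -/
def toModelPlace : Places F → ModelPlaces F
  | .inl w => .inr w
  | .inr w => .inl (FinitePlace.maximalIdeal w)

/-- **The realification on objects** `(†𝓕⊛_𝔪𝔬𝔡)_α → (†𝓕⊛ℝ_𝔪𝔬𝔡)_α` ([IUTchIII] Prop. 3.7 (ii) p. 110 l. 48–49;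
[FrdI] Prop. 5.3): an integral family of fractional ideals IS a real one (abc-iut-L6-d3's `ModelFrakObj`).
[claim: Mochizuki2012, status: disputed] -/
def realifyObj (J : FrakObj (Places F) (Gamma F)) : ModelFrakObj F :=
  ⟨realifyCls F J, by
    refine (J.finite.image (toModelPlace F)).subset ?_
    rintro (v | w) h
    · refine ⟨.inr (FinitePlace.mk v), ?_, ?_⟩
      · intro h0
        exact h (by rw [realifyCls_inl, h0, Int.cast_zero])
      · show Sum.inl (FinitePlace.maximalIdeal (FinitePlace.mk v)) = Sum.inl v
        rw [FinitePlace.maximalIdeal_mk]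
    · exact ⟨.inl w, h, rfl⟩⟩

/-- The classes of the realified object. [claim: Mochizuki2012, status: disputed] -/
@[simp] theorem realifyObj_cls (J : FrakObj (Places F) (Gamma F)) (p : ModelPlaces F) :
    (realifyObj F J).cls p = realifyCls F J p := rfl

/-- Realification on objects is additive (tensor products of fractional ideals go to tensor products):
the additive homomorphism `FrakObj (integral) →+ ModelFrakObj F`. [claim: Mochizuki2012, status: disputed] -/
def realifyObjHom : FrakObj (Places F) (Gamma F) →+ ModelFrakObj F where
  toFun := realifyObj F
  map_zero' := by
    refine FrakObj.ext_cls (funext fun p => ?_)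
    rcases p with v | w
    · show (((0 : FrakObj (Places F) (Gamma F)).cls (.inr (FinitePlace.mk v)) : ℤ) : ℝ) = 0
      rw [FrakObj.cls_zero]
      exact Int.cast_zero
    · rfl
  map_add' J₁ J₂ := by
    refine FrakObj.ext_cls (funext fun p => ?_)
    rcases p with v | w
    · show (((J₁ + J₂).cls (.inr (FinitePlace.mk v)) : ℤ) : ℝ) =
        ((J₁.cls (.inr (FinitePlace.mk v)) : ℤ) : ℝ) + ((J₂.cls (.inr (FinitePlace.mk v)) : ℤ) : ℝ)
      rw [FrakObj.cls_add]
      exact Int.cast_add _ _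
    · rfl

/-- `realifyObjHom` is `realifyObj`. [claim: Mochizuki2012, status: disputed] -/
@[simp] theorem realifyObjHom_apply (J : FrakObj (Places F) (Gamma F)) : realifyObjHom F J = realifyObj F J :=
  rfl

/-- Realification is INJECTIVE on objects (`ℤ ↪ ℝ`; every finite place is `w(v)` for its maximal ideal `v`).
[claim: Mochizuki2012, status: disputed] -/
theorem realifyObj_injective : Function.Injective (realifyObj F) := by
  intro J₁ J₂ h
  refine FrakObj.ext_cls (funext fun p => ?_)
  rcases p with w | w
  · have h' := congrArg (fun X : ModelFrakObj F => X.cls (.inr w)) h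
    exact h'
  · have h' : (((J₁.cls (.inr (FinitePlace.mk (FinitePlace.maximalIdeal w))) : ℤ) : ℝ)) =
        ((J₂.cls (.inr (FinitePlace.mk (FinitePlace.maximalIdeal w))) : ℤ) : ℝ) :=
      congrArg (fun X : ModelFrakObj F => X.cls (.inl (FinitePlace.maximalIdeal w))) h
    rw [FinitePlace.mk_maximalIdeal] at h'
    exact Int.cast_injective h'

/-! ### Compatibility with `β_v` and with effectivity -/

/-- At a finite place, abc-iut-L6-d1's `β_v = ord_v` (read in `ℝ`) is the cast of the integral `β` of
abc-iut-w4-d005's datum (abc-iut-L1-t3's `ordFin` at Mathlib's finite place of `v`): the two `ord_v`'s agree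
(`Literature.IUT.LogVolume.ordFin_mk_eq_ord`, abc-iut-L6-d3's `betaFin_apply`). [claim: Mochizuki2012, status: disputed] -/
theorem betaModel_inl_eq_cast_beta (v : HeightOneSpectrum (𝓞 F)) (f : Fˣ) :
    betaModel (Sum.inl v : ModelPlaces F) (Additive.ofMul f) =
      ((beta F (.inr (FinitePlace.mk v)) (Additive.ofMul f) : ℤ) : ℝ) := by
  rw [beta_inr, Literature.IUT.LogVolume.ordFin_mk_eq_ord]
  exact betaFin_apply v f

/-- At an archimedean place both data carry `−log |f|_v`. [claim: Mochizuki2012, status: disputed] -/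
theorem betaModel_inr_eq_beta (w : InfinitePlace F) (f : Fˣ) :
    betaModel (Sum.inr w : ModelPlaces F) (Additive.ofMul f) = (beta F (.inl w) (Additive.ofMul f) : ℝ) := rfl

/-- **Principal families correspond**: the realification of the integral principal family `(β_v(f))_v`
(abc-iut-L6-t6's `betaDiv` for the integral datum) is the real principal family (`betaDiv` for
abc-iut-L6-d1's datum) — "the identity morphism `F^×_mod → F^×_mod` on the associated rational function monoids".
[claim: Mochizuki2012, status: disputed] -/
theorem realifyObj_betaDiv (f : Fˣ) :
    realifyObj F (Multiplicative.toAdd (betaDiv (modelHyps F) f)) =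
      Multiplicative.toAdd (betaDiv (F := F) (V := ModelPlaces F) (Γ := fun _ => ℝ) (nonneg := nonnegModel)
        (β := betaModel) (modelHyps_places F) f) := by
  refine FrakObj.ext_cls (funext fun p => ?_)
  rcases p with v | w
  · rw [realifyObj_cls, realifyCls_inl, cls_betaDiv, cls_betaDiv, betaModel_inl_eq_cast_beta]
  · rw [realifyObj_cls, realifyCls_inr, cls_betaDiv, cls_betaDiv, betaModel_inr_eq_beta]

/-- **Effectivity corresponds**: an integral family is effective (all classes in `Γ_v^{≥0}`) iff its
realification is (`(k : ℝ) ≥ 0 ↔ k ≥ 0`). [claim: Mochizuki2012, status: disputed] -/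
theorem realifyObj_mem_effDiv_iff (J : FrakObj (Places F) (Gamma F)) :
    realifyObj F J ∈ effDiv (ModelPlaces F) (fun _ => ℝ) nonnegModel ↔
      J ∈ effDiv (Places F) (Gamma F) (nonneg F) := by
  rw [mem_effDiv, mem_effDiv]
  constructor
  · rintro h (w | w)
    · exact (mem_nonneg_inl F w _).mpr (h (.inr w))
    · have h' : (0 : ℝ) ≤ ((J.cls (.inr (FinitePlace.mk (FinitePlace.maximalIdeal w))) : ℤ) : ℝ) :=
        h (.inl (FinitePlace.maximalIdeal w))
      rw [FinitePlace.mk_maximalIdeal] at h'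
      exact (mem_nonneg_inr F w _).mpr (Int.cast_nonneg_iff.mp h')
  · rintro h (v | w)
    · show (0 : ℝ) ≤ ((J.cls (.inr (FinitePlace.mk v)) : ℤ) : ℝ)
      exact Int.cast_nonneg_iff.mpr ((mem_nonneg_inr F _ _).mp (h (.inr (FinitePlace.mk v))))
    · show (0 : ℝ) ≤ (J.cls (.inl w) : ℝ)
      exact (mem_nonneg_inl F w _).mp (h (.inl w))

/-! ### The realification functor -/

omit [NumberField F] in
/-- The integrality condition, unfolded (abc-iut-L6-t4's `FrakObj.IsHom` / `IsElemHom` / `tensorPow`):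
`(n, f) : 𝔍₁ → 𝔍₂` iff `β_v(f) + n·[λ_{1,v}] − [λ_{2,v}] ∈ Γ_v^{≥0}` for every `v`. [claim: Mochizuki2012, status: disputed] -/
theorem isHom_iff {V : Type} {Γ : V → Type} [∀ v, AddCommGroup (Γ v)] {nn : ∀ v, AddSubmonoid (Γ v)}
    {b : ∀ v, Additive Fˣ →+ Γ v} (J₁ J₂ : FrakObj V Γ) (n : ℕ+) (f : Fˣ) :
    FrakObj.IsHom (nonneg := nn) (β := b) J₁ J₂ n f ↔
      ∀ v, b v (Additive.ofMul f) + ((n : ℕ) : ℤ) • J₁.cls v - J₂.cls v ∈ nn v :=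
  Iff.rfl

/-- The real integrality expression at a finite place is the cast of the integral one.
[claim: Mochizuki2012, status: disputed] -/
theorem realify_expr_inl (J₁ J₂ : FrakObj (Places F) (Gamma F)) (n : ℕ+) (f : Fˣ)
    (v : HeightOneSpectrum (𝓞 F)) :
    betaModel (Sum.inl v : ModelPlaces F) (Additive.ofMul f) +
        ((n : ℕ) : ℤ) • (realifyObj F J₁).cls (.inl v) - (realifyObj F J₂).cls (.inl v) =
      (((beta F (.inr (FinitePlace.mk v)) (Additive.ofMul f) +
          ((n : ℕ) : ℤ) • J₁.cls (.inr (FinitePlace.mk v)) - J₂.cls (.inr (FinitePlace.mk v)) :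
            Gamma F (.inr (FinitePlace.mk v))) : ℤ) : ℝ) := by
  rw [betaModel_inl_eq_cast_beta, realifyObj_cls, realifyObj_cls, realifyCls_inl, realifyCls_inl]
  push_cast [zsmul_eq_mul]
  ring

/-- The real integrality expression at an archimedean place is the integral one.
[claim: Mochizuki2012, status: disputed] -/
theorem realify_expr_inr (J₁ J₂ : FrakObj (Places F) (Gamma F)) (n : ℕ+) (f : Fˣ) (w : InfinitePlace F) :
    betaModel (Sum.inr w : ModelPlaces F) (Additive.ofMul f) +
        ((n : ℕ) : ℤ) • (realifyObj F J₁).cls (.inr w) - (realifyObj F J₂).cls (.inr w) =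
      (beta F (.inl w) (Additive.ofMul f) + ((n : ℕ) : ℤ) • J₁.cls (.inl w) - J₂.cls (.inl w) :
        Gamma F (.inl w)) := rfl

/-- The integrality condition of a pair `(n, f)` between integral families transfers to their
realifications and back (`(k : ℝ) ≥ 0 ↔ k ≥ 0` at finite places; identical at archimedean ones).
[claim: Mochizuki2012, status: disputed] -/
theorem isHom_realifyObj_iff (J₁ J₂ : FrakObj (Places F) (Gamma F)) (n : ℕ+) (f : Fˣ) :
    FrakObj.IsHom (nonneg := nonnegModel) (β := betaModel) (realifyObj F J₁) (realifyObj F J₂) n f ↔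
      FrakObj.IsHom (nonneg := nonneg F) (β := beta F) J₁ J₂ n f := by
  rw [isHom_iff, isHom_iff]
  constructor
  · rintro h (w | w)
    · have h' := (AddSubmonoid.mem_nonneg).mp (h (.inr w))
      rw [realify_expr_inr] at h'
      exact (mem_nonneg_inl F w _).mpr h'
    · have h' := (AddSubmonoid.mem_nonneg).mp (h (.inl (FinitePlace.maximalIdeal w)))
      rw [realify_expr_inl, FinitePlace.mk_maximalIdeal, Int.cast_nonneg_iff] at h'
      exact (mem_nonneg_inr F w _).mpr h'
  · rintro h (v | w)
    · refine (AddSubmonoid.mem_nonneg).mpr ?_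
      rw [realify_expr_inl, Int.cast_nonneg_iff]
      exact (mem_nonneg_inr F _ _).mp (h (.inr (FinitePlace.mk v)))
    · refine (AddSubmonoid.mem_nonneg).mpr ?_
      rw [realify_expr_inr]
      exact (mem_nonneg_inl F w _).mp (h (.inl w))

/-- **The ℝ-divisor enlargement functor of `(†𝓕⊛_𝔪𝔬𝔡)_α`** (codomain = objects of `(†𝓕⊛ℝ_𝔪𝔬𝔡)_α`, rational
functions still `F^×_mod`; [IUTchIII] Prop. 3.7 (ii) p. 110 l. 48–49; its OBJECT map is that of [FrdI] Prop. 5.3's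
realification, whose morphism level — `f ↦ Div(f) ∈ ℝ·Φ^birat` — is not constructed here, see the header's AUDIT
NOTE): objects are realified, a morphism `(n, f)` goes to `(n, f)` — the same Frobenius degree and the same
rational function. [claim: Mochizuki2012, status: disputed] -/
def realify : Ffrak F ⥤ FrakCat F (ModelPlaces F) (fun _ => ℝ) nonnegModel betaModel where
  obj X := FrakCat.of (realifyObj F X.obj)
  map {X Y} φ := FrakCat.homMk (FrakCat.deg φ) (FrakCat.fn φ)
    ((isHom_realifyObj_iff F X.obj Y.obj _ _).mpr (FrakCat.Hom.isHom φ))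
  map_id _ := FrakCat.hom_ext rfl rfl
  map_comp _ _ := FrakCat.hom_ext rfl rfl

/-- `realify` on objects. [claim: Mochizuki2012, status: disputed] -/
@[simp] theorem realify_obj_obj (X : Ffrak F) : ((realify F).obj X).obj = realifyObj F X.obj := rfl

/-- `realify` preserves the Frobenius degree. [claim: Mochizuki2012, status: disputed] -/
@[simp] theorem deg_realify_map {X Y : Ffrak F} (φ : X ⟶ Y) :
    FrakCat.deg ((realify F).map φ) = FrakCat.deg φ := rfl

/-- `realify` preserves the rational function: "the identity morphism `F^×_mod → F^×_mod` on the associated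
rational function monoids" ([IUTchIII] Ex. 3.6 (ii) p. 108). [claim: Mochizuki2012, status: disputed] -/
@[simp] theorem fn_realify_map {X Y : Ffrak F} (φ : X ⟶ Y) :
    FrakCat.fn ((realify F).map φ) = FrakCat.fn φ := rfl

/-- The enlargement functor is FAITHFUL (print's realification `𝒞 → 𝒞^rlf` is NOT — header AUDIT NOTE).
[claim: Mochizuki2012, status: disputed] -/
theorem realify_faithful : (realify F).Faithful where
  map_injective {_ _} := fun _ _ h => by
    have h₁ := congrArg FrakCat.deg h
    have h₂ := congrArg FrakCat.fn h
    exact FrakCat.hom_ext h₁ h₂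

/-- The enlargement functor is FULL (print's realification `𝒞 → 𝒞^rlf` is NOT — header AUDIT NOTE): a
real-integral pair `(n, f)` between realified integral objects is already integral.
[claim: Mochizuki2012, status: disputed] -/
theorem realify_full : (realify F).Full where
  map_surjective {X Y} ψ :=
    ⟨FrakCat.homMk (FrakCat.deg ψ) (FrakCat.fn ψ) ((isHom_realifyObj_iff F X.obj Y.obj _ _).mp (FrakCat.Hom.isHom ψ)),
      FrakCat.hom_ext rfl rfl⟩

/-- The enlargement functor (= the realification on objects) is injective on objects.
[claim: Mochizuki2012, status: disputed] -/
theorem realify_obj_injective : Function.Injective (realify F).obj := fun _ _ h =>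
  realifyObj_injective F (congrArg FrakCat.obj h)

end Prop37

end Literature.IUT.LogThetaLattice

end
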